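import Summits.Ventures.QEC.Census.FoldLin
import Summits.Ventures.QEC.Census.CertBZWords
import HarnessLib

/-!
# Fold enumeration — linear-algebra lemmas, part 2: masks of lists, `bitsOf`, `popc` as a cardinality

Continuation of `Census/FoldLin.lean`.
-/

namespace Summit.Ventures.QEC.Census.Fold

open Summit.Ventures.QEC.Census Finset


/-- `maskOf_cons`: maskOf cons (auxiliary lemma of the fold-certificate soundness chain). -/
theorem maskOf_cons (j : ℕ) (J : List ℕ) : maskOf (j :: J) = 2 ^ j ^^^ maskOf J := rfl
/-- `maskOf_nil`: maskOf nil (auxiliary lemma of the fold-certificate soundness chain). -/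
@[simp] theorem maskOf_nil : maskOf [] = 0 := rfl

/-- `maskOf_append`: maskOf append (auxiliary lemma of the fold-certificate soundness chain). -/
theorem maskOf_append (J K : List ℕ) : maskOf (J ++ K) = maskOf J ^^^ maskOf K := xorIdx_append _ _ _

/-- `maskOf_lt`: maskOf lt (auxiliary lemma of the fold-certificate soundness chain). -/
theorem maskOf_lt (n : ℕ) (J : List ℕ) (hJ : ∀ j ∈ J, j < n) : maskOf J < 2 ^ n := by
  induction J with
  | nil => exact Nat.two_pow_pos n
  | cons j J ih =>
    rw [maskOf_cons]
    exact Nat.xor_lt_two_pow (Nat.pow_lt_pow_right (by norm_num) (hJ j (by simp)))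
      (ih fun x hx => hJ x (by simp [hx]))

/-! ## `bitsOf` -/

/-- `bitsOf_succ`: bitsOf succ (auxiliary lemma of the fold-certificate soundness chain). -/
theorem bitsOf_succ (n i0 u : ℕ) :
    bitsOf (n + 1) i0 u = (if u % 2 = 1 then i0 :: bitsOf n (i0 + 1) (u / 2) else bitsOf n (i0 + 1) (u / 2)) := rfl

/-- `mem_bitsOf_bound`: mem bitsOf bound (auxiliary lemma of the fold-certificate soundness chain). -/
theorem mem_bitsOf_bound (n : ℕ) : ∀ (i0 u j : ℕ), j ∈ bitsOf n i0 u → i0 ≤ j ∧ j < i0 + n := by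
  induction n with
  | zero => intro i0 u j h; simp [bitsOf] at h
  | succ n ih =>
    intro i0 u j h
    rw [bitsOf_succ] at h
    split at h
    · rcases List.mem_cons.1 h with rfl | h
      · omega
      · have := ih _ _ _ h; omega
    · have := ih _ _ _ h; omega

/-- `lt_of_mem_bitsOf`: lt of mem bitsOf (auxiliary lemma of the fold-certificate soundness chain). -/
theorem lt_of_mem_bitsOf {n u j : ℕ} (h : j ∈ bitsOf n 0 u) : j < n := by
  have := mem_bitsOf_bound n 0 u j h; omega

/-- `maskOf (bitsOf …)` restores the word (window version). -/
theorem maskOf_bitsOf (n : ℕ) : ∀ (i0 u : ℕ), maskOf (bitsOf n i0 u) = 2 ^ i0 * (u % 2 ^ n) := by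
  induction n with
  | zero => intro i0 u; simp [bitsOf, Nat.mod_one]
  | succ n ih =>
    intro i0 u
    rw [bitsOf_succ]
    have hu : u % 2 ^ (n + 1) = u % 2 + 2 * (u / 2 % 2 ^ n) := by rw [Nat.pow_succ', Nat.mod_mul]
    split
    · rename_i h1
      rw [maskOf_cons, ih, hu, h1, Nat.mul_add, Nat.mul_one, Nat.pow_succ, Nat.mul_assoc]
      -- 2^i0 ^^^ 2^i0*2*x = 2^i0*2*x + 2^i0  (disjoint bits)
      rw [Nat.add_comm, show 2 ^ i0 * (2 * (u / 2 % 2 ^ n)) = 2 ^ (i0 + 1) * (u / 2 % 2 ^ n) from by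
        rw [Nat.pow_succ]; ring]
      rw [Nat.two_pow_add_eq_or_of_lt (Nat.pow_lt_pow_right (by norm_num) (by omega)), Nat.xor_comm]
      -- a ||| b = a ^^^ b when disjoint
      apply Nat.eq_of_testBit_eq; intro i
      rw [Nat.testBit_xor, Nat.testBit_or, Nat.testBit_two_pow_mul, Nat.testBit_two_pow]
      by_cases hi : i0 = i
      · subst hi; simp
      · simp [hi]
    · rename_i h1
      have h0 : u % 2 = 0 := by omega
      rw [ih, hu, h0, Nat.zero_add, Nat.pow_succ]; ring

/-- `maskOf_bitsOf_zero`: maskOf bitsOf zero (auxiliary lemma of the fold-certificate soundness chain). -/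
theorem maskOf_bitsOf_zero (n u : ℕ) (hu : u < 2 ^ n) : maskOf (bitsOf n 0 u) = u := by
  rw [maskOf_bitsOf, Nat.pow_zero, Nat.one_mul, Nat.mod_eq_of_lt hu]

/-- The support list has `popc` elements. -/
theorem length_bitsOf (n : ℕ) : ∀ (i0 u : ℕ), (bitsOf n i0 u).length = popc n u := by
  induction n with
  | zero => intro i0 u; rfl
  | succ n ih =>
    intro i0 u
    rw [bitsOf_succ, popc]
    split
    · rename_i h; rw [List.length_cons, ih, h]; omega
    · rename_i h; have : u % 2 = 0 := by omega
      rw [ih, this]; omega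

/-! ## Bit counts -/

/-- `popc_succ`: popc succ (auxiliary lemma of the fold-certificate soundness chain). -/
theorem popc_succ (n u : ℕ) : popc (n + 1) u = u % 2 + popc n (u / 2) := rfl

/-- INCLUSION–EXCLUSION for bits: `popc (a ⊕ b) + 2 popc (a ∧ b) = popc a + popc b`. -/
theorem popc_xor_add (n : ℕ) : ∀ (a b : ℕ), popc n (a ^^^ b) + 2 * popc n (a &&& b) = popc n a + popc n b := by
  induction n with
  | zero => intro a b; rfl
  | succ n ih =>
    intro a b
    simp only [popc_succ, xor_mod_two, xor_div_two, (and_mod_two_div_two a b).1, (and_mod_two_div_two a b).2]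
    have := ih (a / 2) (b / 2)
    rcases Nat.mod_two_eq_zero_or_one a with ha | ha <;> rcases Nat.mod_two_eq_zero_or_one b with hb | hb <;>
      simp only [ha, hb] <;> omega

/-- `popc_mod`: popc mod (auxiliary lemma of the fold-certificate soundness chain). -/
theorem popc_mod (n u : ℕ) : popc n (u % 2 ^ n) = popc n u := by
  induction n generalizing u with
  | zero => rfl
  | succ n ih =>
    rw [popc_succ, popc_succ]
    have h1 : u % 2 ^ (n + 1) % 2 = u % 2 := by rw [Nat.pow_succ', Nat.mod_mul]; omega
    have h2 : u % 2 ^ (n + 1) / 2 = u / 2 % 2 ^ n := by rw [Nat.pow_succ', Nat.mod_mul_right_div_self]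
    rw [h1, h2, ih]

/-- `popc` as the cardinality of the set of set bits below `n`. -/
theorem popc_eq_card (n u : ℕ) : popc n u = #{i ∈ range n | u.testBit i = true} := by
  rw [popc_eq_sum, Fin.sum_univ_eq_sum_range (fun i => (u.testBit i).toNat), Finset.card_filter]
  refine Finset.sum_congr rfl fun i _ => ?_
  cases u.testBit i <;> rfl

/-- An injective placement of bits preserves the bit count. -/
theorem popc_lin_pow_inj (σ : ℕ → ℕ) (n m u : ℕ)
    (hinj : ∀ k₁ k₂, k₁ < n → k₂ < n → σ k₁ = σ k₂ → k₁ = k₂) (hlt : ∀ k, k < n → σ k < m) :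
    popc m (lin (fun k => 2 ^ σ k) n 0 u) = popc n u := by
  rw [popc_eq_card, popc_eq_card]
  symm
  apply Finset.card_nbij σ
  · intro k hk
    simp only [Finset.coe_filter, Finset.mem_range, Set.mem_setOf_eq] at hk ⊢
    refine ⟨hlt k hk.1, ?_⟩
    rw [testBit_lin_pow_iff σ n 0 u (σ k) (fun k₁ k₂ h₁ h₂ he => hinj k₁ k₂ h₁ h₂ (by simpa using he))]
    exact ⟨k, hk.1, hk.2, by simp⟩
  · intro k₁ hk₁ k₂ hk₂ he
    simp only [Finset.coe_filter, Finset.mem_range, Set.mem_setOf_eq] at hk₁ hk₂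
    exact hinj k₁ k₂ hk₁.1 hk₂.1 he
  · intro i hi
    simp only [Finset.coe_filter, Finset.mem_range, Set.mem_setOf_eq] at hi
    obtain ⟨k, hk, hu, hσ⟩ := (testBit_lin_pow_iff σ n 0 u i
      (fun k₁ k₂ h₁ h₂ he => hinj k₁ k₂ h₁ h₂ (by simpa using he))).1 hi.2
    exact ⟨k, by simp [hk, hu], by simpa using hσ⟩

end Summit.Ventures.QEC.Census.Fold
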